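import Summits.Ventures.PercRepro.C041ZoneLemmaConj
import Summits.Ventures.PercRepro.C041ZoneReductionINV
import Summits.Ventures.PercRepro.C041ZoneZF

/-!
# The whole skeleton as a zone with forced edges (p6, gen 27; C-041.md §13, THEOREM (INV), the dictionary — part 1)

A skeleton `(G; a, b, c)` with a bare colouring `O` is read as a zone with forced edges (`skelZone`, an `FZone` of
`C041ZoneZFDefs`): the vertices are those of `G`; the edges are the edges that are neither `1`-edges (joining a
non-terminal to `a`, `TermA`) nor `2`-edges (`TermB`) — the bare edges, the edges between the terminals and the loops at
the terminals (`EdgeN`); the `1`- and `2`-edges are the terminal edges (`TEdge1`, `TEdge2`) with their non-terminal end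
(`nonTermEnd`); the FREE edges are the interior blue edges `B(O)` (and the loops at the terminals, which nothing
constrains), every other edge is forced to its `O`-colour (the edges between the terminals to red); the blue-isolated
region `iso` is the set of non-terminals whose zone carries no terminal edge.  A configuration of `G` and a state of
the zone are the same data (`toState`, `ofState`, inverse to each other: `ofState_toState`, `toState_ofState`).
Proved here: the structure axioms of `skelZone`, the inverse laws, and the basic facts on `EdgeN` (an edge of `EdgeN`
at a non-terminal is bare: `bare_of_edgeN`; an edge of `EdgeN` that is not bare joins two terminals).
-/

namespace PercRepro

namespace MultiGraph

open Finset ZoneZ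

variable {V E : Type*} (G : MultiGraph V E) (a b : V)

/-- A `1`-edge of the skeleton: an edge joining a non-terminal to `a`. -/
def TermA (e : E) : Prop := ∃ v, v ≠ a ∧ v ≠ b ∧ G.Joins e v a

/-- A `2`-edge of the skeleton: an edge joining a non-terminal to `b`. -/
def TermB (e : E) : Prop := ∃ v, v ≠ a ∧ v ≠ b ∧ G.Joins e v b

/-- The edges that are neither `1`- nor `2`-edges: the bare edges, the edges between the terminals, the loops at the
terminals. -/
abbrev EdgeN := {e : E // ¬ G.TermA a b e ∧ ¬ G.TermB a b e}

/-- The `1`-edges, as a type. -/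
abbrev TEdge1 := {e : E // G.TermA a b e}

/-- The `2`-edges, as a type. -/
abbrev TEdge2 := {e : E // G.TermB a b e}

open Classical in
/-- The non-terminal end of a terminal edge. -/
noncomputable def nonTermEnd (e : E) : V := if G.fst e = a ∨ G.fst e = b then G.snd e else G.fst e

variable {G a b}

/-- The non-terminal end of an edge joining the non-terminal `v` to a terminal is `v`. -/
theorem nonTermEnd_eq {e : E} {v t : V} (hv : v ≠ a ∧ v ≠ b) (ht : t = a ∨ t = b) (hj : G.Joins e v t) :
    G.nonTermEnd a b e = v := by
  unfold nonTermEnd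
  rcases hj with ⟨h1, h2⟩ | ⟨h1, h2⟩
  · rw [if_neg]
    · exact h1
    · rw [h1]
      rintro (h | h)
      · exact hv.1 h
      · exact hv.2 h
  · rw [if_pos]
    · exact h2
    · rw [h1]
      exact ht

/-- A bare edge is not a `1`-edge. -/
theorem not_termA_of_bare {e : E} (he : G.Bare a b e) : ¬ G.TermA a b e := by
  rintro ⟨v, _, _, hj⟩
  exact he.1 (EdgeAt.of_joins_right hj)

/-- A bare edge is not a `2`-edge. -/
theorem not_termB_of_bare {e : E} (he : G.Bare a b e) : ¬ G.TermB a b e := by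
  rintro ⟨v, _, _, hj⟩
  exact he.2 (EdgeAt.of_joins_right hj)

/-- With distinct terminals a `2`-edge is not a `1`-edge. -/
theorem not_termA_of_termB (hne : a ≠ b) {e : E} (h : G.TermB a b e) : ¬ G.TermA a b e := by
  obtain ⟨v, hva, hvb, hj⟩ := h
  rintro ⟨v', hv'a, hv'b, hj'⟩
  rcases hj with ⟨h1, h2⟩ | ⟨h1, h2⟩ <;> rcases hj' with ⟨h3, h4⟩ | ⟨h3, h4⟩
  · exact hne (h4.symm.trans h2)
  · exact hva (h1.symm.trans h3)
  · exact hv'b (h3.symm.trans h1)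
  · exact hne (h3.symm.trans h1)

/-- An edge of `EdgeN` joining a non-terminal to anything is bare. -/
theorem bare_of_edgeN {e : E} (he : ¬ G.TermA a b e ∧ ¬ G.TermB a b e) {u v : V} (hu : u ≠ a ∧ u ≠ b)
    (hj : G.Joins e u v) : G.Bare a b e := by
  constructor
  · intro h
    have hva : v = a := by
      rcases hj with ⟨h1, h2⟩ | ⟨h1, h2⟩ <;> rcases h with h | h
      · exact absurd (h1.symm.trans h) hu.1
      · exact h2.symm.trans h
      · exact h1.symm.trans h
      · exact absurd (h2.symm.trans h) hu.1
    exact he.1 ⟨u, hu.1, hu.2, hva ▸ hj⟩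
  · intro h
    have hvb : v = b := by
      rcases hj with ⟨h1, h2⟩ | ⟨h1, h2⟩ <;> rcases h with h | h
      · exact absurd (h1.symm.trans h) hu.2
      · exact h2.symm.trans h
      · exact h1.symm.trans h
      · exact absurd (h2.symm.trans h) hu.2
    exact he.2 ⟨u, hu.1, hu.2, hvb ▸ hj⟩

/-- An edge of `EdgeN` that is not bare has both ends at the terminals. -/
theorem ends_terminal_of_edgeN_not_bare {e : E} (he : ¬ G.TermA a b e ∧ ¬ G.TermB a b e)
    (hb : ¬ G.Bare a b e) : (G.fst e = a ∨ G.fst e = b) ∧ (G.snd e = a ∨ G.snd e = b) := by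
  by_contra h
  rw [not_and_or] at h
  rcases h with h | h
  · exact hb (bare_of_edgeN he ⟨fun h' => h (Or.inl h'), fun h' => h (Or.inr h')⟩ (Or.inl ⟨rfl, rfl⟩))
  · exact hb (bare_of_edgeN he ⟨fun h' => h (Or.inl h'), fun h' => h (Or.inr h')⟩ (Or.inr ⟨rfl, rfl⟩))

variable (G a b)

/-- The blue-isolated region of the skeleton: the non-terminals whose zone carries no terminal edge. -/
def isoSet (O : Config E) : Set V :=
  {v | v ≠ a ∧ v ≠ b ∧ ¬ ∃ w, G.BlueBareConn a b O v w ∧ ∃ e', G.Joins e' w a ∨ G.Joins e' w b}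

variable {G a b}

/-- A vertex of `isoSet` is a non-terminal. -/
theorem ne_terminal_of_mem_isoSet {O : Config E} {v : V} (hv : v ∈ G.isoSet a b O) : v ≠ a ∧ v ≠ b := ⟨hv.1, hv.2.1⟩

/-- A vertex blue-bare-connected to a vertex of `isoSet` lies in `isoSet`. -/
theorem mem_isoSet_of_blueBareConn {O : Config E} {v w : V} (hv : v ∈ G.isoSet a b O)
    (h : G.BlueBareConn a b O v w) : w ∈ G.isoSet a b O := by
  obtain ⟨hva, hvb, hv⟩ := hv
  have hw := ne_terminal_of_blueBareConn h ⟨hva, hvb⟩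
  refine ⟨hw.1, hw.2, ?_⟩
  rintro ⟨w', hww', he'⟩
  exact hv ⟨w', h.trans hww', he'⟩

/-- A vertex of `isoSet` is not the non-terminal end of a terminal edge. -/
theorem not_mem_isoSet_of_joins {O : Config E} {v t : V} {e : E} (ht : t = a ∨ t = b) (hj : G.Joins e v t) :
    v ∉ G.isoSet a b O := by
  rintro ⟨_, _, hv⟩
  refine hv ⟨v, BlueBareConn.refl a b O v, e, ?_⟩
  rcases ht with rfl | rfl
  · exact Or.inl hj
  · exact Or.inr hj

variable (G a b)

open Classical in
/-- **The skeleton as a zone with forced edges**: vertices `V`, edges `EdgeN`, terminal edges `TEdge1` / `TEdge2`;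
free = the interior blue edges of `O` (and the loops at the terminals), forced colour = the `O`-colour of a bare edge
(red for an edge between the terminals); `iso` = the non-terminals whose zone carries no terminal edge. -/
noncomputable def skelZone (O : Config E) : FZone V (G.EdgeN a b) (G.TEdge1 a b) (G.TEdge2 a b) where
  fst e := G.fst e.1
  snd e := G.snd e.1
  at₁ t := G.nonTermEnd a b t.1
  at₂ t := G.nonTermEnd a b t.1
  free e := G.InteriorBlue a b O e.1 ∨ (¬ G.Bare a b e.1 ∧ ¬ G.Joins e.1 a b)
  fcol e := if G.Bare a b e.1 then O e.1 else true
  iso := G.isoSet a b O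
  fblue_mem := by
    rintro ⟨e, he⟩ hfree hcol
    simp only at hfree hcol
    rw [not_or, not_and_or, not_not] at hfree
    obtain ⟨hint, hbare⟩ := hfree
    have hb : G.Bare a b e := by
      by_contra h
      rw [if_neg h] at hcol
      exact absurd hcol (by decide)
    rw [if_pos hb] at hcol
    have hne := ne_of_bare_joins hb (Or.inl ⟨rfl, rfl⟩ : G.Joins e (G.fst e) (G.snd e))
    have hadj : G.BlueBareAdj a b O (G.snd e) (G.fst e) := ⟨e, hb, hcol, Or.inr ⟨rfl, rfl⟩⟩
    have hfst : G.fst e ∈ G.isoSet a b O := by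
      refine ⟨hne.1.1, hne.1.2, ?_⟩
      rintro ⟨w, hw, e', he'⟩
      exact hint ⟨hb, hcol, w, ⟨e', he'⟩, hw.symm⟩
    exact ⟨hfst, mem_isoSet_of_blueBareConn hfst (BlueBareConn.single hadj.symm)⟩
  iso_forced := by
    rintro ⟨e, he⟩ hiso hfree
    simp only at hiso hfree
    rcases hfree with ⟨hb, hO, u, ⟨e', he'⟩, hconn⟩ | ⟨hb, _⟩
    · have hadj : G.BlueBareAdj a b O (G.fst e) (G.snd e) := ⟨e, hb, hO, Or.inl ⟨rfl, rfl⟩⟩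
      have hu : u ∈ G.isoSet a b O := by
        rcases hiso with h | h
        · exact mem_isoSet_of_blueBareConn h hconn.symm
        · exact mem_isoSet_of_blueBareConn h ((BlueBareConn.single hadj.symm).trans hconn.symm)
      exact hu.2.2 ⟨u, BlueBareConn.refl a b O u, e', he'⟩
    · have hends := ends_terminal_of_edgeN_not_bare he hb
      rcases hiso with h | h
      · rcases hends.1 with h' | h'
        · exact h.1 h'
        · exact h.2.1 h'
      · rcases hends.2 with h' | h'
        · exact h.1 h'
        · exact h.2.1 h'
  iso_unmarked₁ := by
    rintro ⟨e, v, hva, hvb, hj⟩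
    simp only
    rw [nonTermEnd_eq ⟨hva, hvb⟩ (Or.inl rfl) hj]
    exact not_mem_isoSet_of_joins (Or.inl rfl) hj
  iso_unmarked₂ := by
    rintro ⟨e, v, hva, hvb, hj⟩
    simp only
    rw [nonTermEnd_eq ⟨hva, hvb⟩ (Or.inr rfl) hj]
    exact not_mem_isoSet_of_joins (Or.inr rfl) hj

/-- A configuration of `G` as a state of the skeleton zone. -/
def toState (S : Config E) : State (G.EdgeN a b) (G.TEdge1 a b) (G.TEdge2 a b) :=
  (fun e => S e.1, fun t => S t.1, fun t => S t.1)

open Classical in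
/-- A state of the skeleton zone as a configuration of `G`. -/
noncomputable def ofState (σ : State (G.EdgeN a b) (G.TEdge1 a b) (G.TEdge2 a b)) : Config E := fun e =>
  if h1 : G.TermA a b e then σ.2.1 ⟨e, h1⟩ else if h2 : G.TermB a b e then σ.2.2 ⟨e, h2⟩ else σ.1 ⟨e, h1, h2⟩

variable {G a b}

/-- `ofState` inverts `toState`. -/
theorem ofState_toState (S : Config E) : G.ofState a b (G.toState a b S) = S := by
  funext e
  unfold ofState toState
  by_cases h1 : G.TermA a b e
  · rw [dif_pos h1]
  · rw [dif_neg h1]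
    by_cases h2 : G.TermB a b e
    · rw [dif_pos h2]
    · rw [dif_neg h2]

/-- `toState` inverts `ofState` (distinct terminals). -/
theorem toState_ofState (hne : a ≠ b) (σ : State (G.EdgeN a b) (G.TEdge1 a b) (G.TEdge2 a b)) :
    G.toState a b (G.ofState a b σ) = σ := by
  obtain ⟨c₁, m₁, m₂⟩ := σ
  unfold toState ofState
  refine Prod.ext (funext fun e => ?_) (Prod.ext (funext fun t => ?_) (funext fun t => ?_))
  · simp only
    rw [dif_neg e.2.1, dif_neg e.2.2]
  · simp only
    rw [dif_pos t.2]
  · simp only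
    rw [dif_neg (not_termA_of_termB hne t.2), dif_pos t.2]

/-- `toState` is injective. -/
theorem toState_injective : Function.Injective (G.toState a b) := by
  intro S S' h
  rw [← ofState_toState (G := G) (a := a) (b := b) S, ← ofState_toState (G := G) (a := a) (b := b) S', h]

/-- `ofState` is injective (distinct terminals). -/
theorem ofState_injective (hne : a ≠ b) : Function.Injective (G.ofState a b) := by
  intro σ σ' h
  rw [← toState_ofState hne σ, ← toState_ofState hne σ', h]

/-- The colour of an edge of `EdgeN` in `toState S`. -/
theorem toState_fst (S : Config E) (e : G.EdgeN a b) : (G.toState a b S).1 e = S e.1 := rfl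

/-- The colour of a `1`-edge in `toState S`. -/
theorem toState_snd_fst (S : Config E) (t : G.TEdge1 a b) : (G.toState a b S).2.1 t = S t.1 := rfl

/-- The colour of a `2`-edge in `toState S`. -/
theorem toState_snd_snd (S : Config E) (t : G.TEdge2 a b) : (G.toState a b S).2.2 t = S t.1 := rfl

end MultiGraph

end PercRepro
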